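/-
Copyright (c) 2026 the pub-hodgecm-mathlib formalisation cell (harness21).  R90-TF SLAB, section S10 (Rogawski 1990, §13.8 read at `v`),
prover R90-C138-p08 (g2) — DEAL #107 (R90-C138-plan (g4) 2026-09-05T04:14:08Z): the keystone's `hbc` FEED OF RECORD as ONE ★ term; h413 = `stmt-HodgeConjecture-24833`,
route `HCCMUnconditional`.
-/
import Summits.HodgeConjecture.HodgeConjecture.Theorems.R90S10HeckeFLInertLetterDefs          -- ★ p865396 (this seat, #95): `HeckeFLInertUnrLetterOdd∕Dyadic`, `hFL_of_letters` (+ ★ p865253 `hbc_of_hex`)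
import Summits.HodgeConjecture.HodgeConjecture.Theorems.R90S10KeystoneT0OfRecord               -- ★ p865345 (p02, #77 FILE 2): `t₀OfRecord`, `hex_ofRecord` (the `t₀` ∕ `hex` OF RECORD at `S = {v}`)
import Literature.NumberTheory.GaloisRepresentations.HeckeCharacterConjugateDualOfQuadraticCM     -- ★ `HeckeCharacter.galConj_eq_inv_of_restrict_eq_quadraticHeckeCharCM` (`hdual` from ⟪P⟫)
import HarnessLib

/-!
# R90-TF ∕ S10 — THE KEYSTONE'S `hbc` FEED OF RECORD AS ONE ★ TERM: `hbc_ofRecord_of_letters` (`Theorems/R90S10HbcOfRecordOfLetters.lean`;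
# ns `Summit.HodgeConjecture.HodgeConjecture.R90.S10`; ONE theorem — no `def`, no instance, no notation, no `sorry`)

Print: [Rogawski1990] §13.8 p. 219 L3 «`π_w = ξ_H(ρ_w)` for all `w ≠ v` and all `π` occurring in the sum»; §4.9 Prop. 4.9.1 (b) p. 55, Lemma 4.9.2 pp. 55–56; §4.13 Lemma 4.13.1 (a)
pp. 64–66; §13.6 p. 209.  [CartierCorvallis1979, §IV.1 Thm. 4.1, Cor. 4.1–4.2].

## WHAT THIS FILE PROVES (DEAL #107)
The ★ keystone `sock₂Sig_of_inputs_adm` (p865249) binds the hadm-form `hbc` («every admissible `U(Φ₃)(𝒪_w)`-spherical class lying over `ρ_w` has Hecke character `(t₀)_w`», every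
`w ≠ v` off `S`).  At the instance OF RECORD — `S := {v}`, `t₀ := t₀OfRecord hunr hμω 𝔣 hPS hUBC` (★ p865345, p02: the (H2♭) package chosen inside FILE D's germ space, with its spec
★ `hex_ofRecord`) — this binder is ONE ★ TERM over A's regime tokens and the section's named letters:
  `hbc_ofRecord_of_letters 𝔣 hunr hμu hμω hodd hdy hPS hUBC := hbc_of_hex … 𝔣 {v} (t₀OfRecord …).1 hunr (galConj_eq_inv_of_restrict_eq_quadraticHeckeCharCM L μ hμω)
     (hFL_of_letters … 𝔣 {v} hμu hμω hunr hodd hdy) (hex_ofRecord hunr hμω 𝔣 hPS hUBC)`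
(★ #84 two-case rigidity assembler ∘ ★ #95 parity-split Hecke-FL letters ∘ ★ #77 `hex` of record ∘ ★ Literature «`μ|_{𝕀_{L⁺}} = ω ⇒ μ^c = μ⁻¹`»), so p01's #102 composite
`stabilisedAtEvp₂_of_suppliers` and typ3's A ED. 11 callback cite it BY NAME instead of re-elaborating the composite (whnf budget).
BINDERS (by value, all A-regime tokens or classed letters): `hunr` ⟪U⟫, `hμu` (μ unitary), `hμω` ⟪P⟫, `hodd : HeckeFLInertUnrLetterOdd L μ v` (`sock_S10_heckeFLInertOdd`, S6-payable),
`hdy : HeckeFLInertUnrLetterDyadic L μ v` (`sock_S10_heckeFLInertDyadic`, EXT cite), `hPS` (the shrunk level-trace binder `hPS♭`, audit F-hex-1; ★ #97 road), `hUBC` ((U-BC): admissible spherical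
classes lying over `ρ_w` are unitarizable — named residual).  Conclusion = the keystone's `hbc` binder VERBATIM at `S := {v}`, `t₀ := (t₀OfRecord hunr hμω 𝔣 hPS hUBC)`.
HONEST LABEL: plumbing over named letters; pays nothing by itself — the letters `hodd`, `hdy`, `hPS`, `hUBC` are UNPROVED named inputs of A's next edition; HC_CM is proved only
modulo the 7 printed citations (2 remaining named inputs: hLiu418 = `stmt-HodgeConjecture-24832`, h413 = `stmt-HodgeConjecture-24833`) until rung 0 closes; REL ≠ ★ ≠ BUILT.
-/

set_option autoImplicit false
set_option linter.dupNamespace false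

noncomputable section

open scoped RestrictedProduct Matrix MatrixGroups
open Filter MeasureTheory NumberField IsDedekindDomain CompactlySupported
open Literature.NumberTheory.Rogawski1990 Literature.NumberTheory.Automorphic Literature.NumberTheory.Automorphic.UnitaryGroup
open Literature.NumberTheory.Automorphic.UnitaryGroup.CotangentForms Literature.NumberTheory.GaloisRepresentations
open Literature.NumberTheory.Automorphic.Arthur2013.Leaves.TECR
open Summit.HodgeConjecture.HodgeConjecture.Cruxes.H413
open Summit.HodgeConjecture.HodgeConjecture.Cruxes.H413.K2E1TraceFormulaBeta
open Summit.HodgeConjecture.HodgeConjecture.Cruxes.H413.K2E1SpectralTermsDiscreteHalf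
open Summit.HodgeConjecture.HodgeConjecture.Cruxes.H413.K2E1EigenvaluePackageOfSpherical
open Summit.HodgeConjecture.HodgeConjecture.Cruxes.H413.K2E1EvpOfAutomorphicClass

namespace Summit.HodgeConjecture.HodgeConjecture.R90.S10

section Frozen

variable {L : Type} [Field L] [NumberField L] [IsCMField L] [DecidableEq (Pl L)] {μ : HeckeCharacter L} {v : Pl L}
  [MeasurableSpace (HLoc L v)] [BorelSpace (HLoc L v)] [MeasurableSpace (Gqs L v)] [BorelSpace (Gqs L v)]
  {νHv : Measure (HLoc L v)} {νQv : Measure (Gqs L v)} [νHv.IsHaarMeasure] [νHv.IsMulRightInvariant] [νQv.IsHaarMeasure] [νQv.IsMulRightInvariant]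
  [∀ a : HLoc L v, MeasurableSpace (HLoc L v ⧸ Subgroup.centralizer ({a} : Set (HLoc L v)))]
  [∀ a : HLoc L v, BorelSpace (HLoc L v ⧸ Subgroup.centralizer ({a} : Set (HLoc L v)))]
  [∀ γ : Gqs L v, MeasurableSpace (Gqs L v ⧸ Subgroup.centralizer ({γ} : Set (Gqs L v)))]
  [∀ γ : Gqs L v, BorelSpace (Gqs L v ⧸ Subgroup.centralizer ({γ} : Set (Gqs L v)))]
  {mHv : OrbitalMeasureFamily (HLoc L v)} {mQv : OrbitalMeasureFamily (Gqs L v)} {πSt : IrrClass (HLoc L v)}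
  [MeasurableSpace (G3 L).Adelic] [BorelSpace (G3 L).Adelic] [MeasurableSpace (H2 L).Adelic] [BorelSpace (H2 L).Adelic]
  [MeasurableSpace (GArch L)] [BorelSpace (GArch L)] [MeasurableSpace (HArch L)] [BorelSpace (HArch L)]
  [MeasurableSpace (H1Loc L v)] [MeasurableSpace (H1Arch L)] [MeasurableSpace (H1 L).Adelic] [BorelSpace (H1 L).Adelic]

/-- **THE KEYSTONE'S `hbc` AT THE INSTANCE OF RECORD (`S := {v}`, `t₀ := t₀OfRecord …`) AS ONE ★ TERM.**  Every admissible `U(Φ₃)(𝒪_w)`-spherical class `πw` lying over `ρ_w`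
(`w ≠ v`) has Hecke character `(t₀OfRecord …)_w`: the (H2♭) witness of record `π₀(w)` (★ `hex_ofRecord`) also lies over `ρ_w` with that character, and the `LiesOver`-fibre is rigid
(★ `hbc_of_hex`: INERT `w` by the spherical-Hecke-algebra FL letters split by parity — ★ `hFL_of_letters` over `hodd`∕`hdy` —, SPLIT `w` by `μ^c = μ⁻¹`, which ⟪P⟫ `hμω` gives by ★
`galConj_eq_inv_of_restrict_eq_quadraticHeckeCharCM`).  Binders = A's regime tokens `hunr hμu hμω` + the classed letters `hodd hdy hPS hUBC`; conclusion = ★ `sock₂Sig_of_inputs_adm`'s `hbc`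
binder VERBATIM at the instance of record. [cite: Rogawski1990, §13.8 p. 219 L3; §4.9 Prop. 4.9.1 (b) p. 55, Lemma 4.9.2 pp. 55–56; §4.13 Lemma 4.13.1 (a) pp. 64–66; §13.6 p. 209]
[cite: CartierCorvallis1979, §IV.1 Thm. 4.1, Cor. 4.1–4.2] -/
theorem hbc_ofRecord_of_letters (𝔣 : S10FrozenDatum L μ v νHv νQv mHv mQv πSt)
    (hunr : ∀ w : Pl L, w ≠ v → ∀ W : PlacesOver L w, Algebra.IsUnramifiedAt (𝓞 ↥(maximalRealSubfield L)) W.1.asIdeal ∧ μ.IsUnramifiedAt W.1)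
    (hμu : μ.IsUnitary)
    (hμω : ∀ x : Literature.NumberTheory.GaloisRepresentations.ideleGroup ↥(maximalRealSubfield L),
      μ (AdeleRing.ideleBaseChange (↥(maximalRealSubfield L)) L x) = quadraticHeckeCharCM L x)
    (hodd : HeckeFLInertUnrLetterOdd L μ v) (hdy : HeckeFLInertUnrLetterDyadic L μ v)
    (hPS : ∀ w : {w : Pl L // w ≠ v}, ∃ (χ₂ : ↥(torusU (conjLocal L (IsCMField.complexConj L) w.1) (cmLocalForm L 2 w.1)) →* ℂˣ) (χ₁ : H1Loc L w.1 →* ℂˣ),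
      IsOpen ((χ₁.ker : Subgroup (H1Loc L w.1)) : Set (H1Loc L w.1)) ∧
        Module.finrank ℂ ↥((cmPrincipalSeriesH L w.1 χ₂ χ₁).fixedPoints (𝔣.𝔥.KH w.1)) = 1 ∧
          (letI := 𝔣.𝔥.acV w.1
           letI := 𝔣.𝔥.mdV w.1
           letI := 𝔣.𝔳.msH w
           ∀ fH : HLoc L w.1 → ℂ, IsLocSmooth fH → IsLevel (𝔣.𝔥.KH w.1) fH →
             (𝔣.𝔥.ρ w.1).smoothTrace (𝔣.𝔳.νHw w) fH = (cmPrincipalSeriesH L w.1 χ₂ χ₁).smoothTrace (𝔣.𝔳.νHw w) fH))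
    (hUBC : ∀ (w : {w : Pl L // w ≠ v}) (π : IrrClass (Gqs L w.1)), π.IsAdmissible → π.IsSpherical (cmLocalIntegralLevel L 3 (qsForm L) w.1) →
      LiesOver L μ w.1 (𝔣.𝔳.K w.1) (𝔣.𝔥.KH w.1) (𝔣.𝔳.νQ w) (𝔣.𝔳.νHw w) (𝔣.𝔳.mH w) (𝔣.𝔳.mQ w) π (𝔣.𝔥.ρ w.1) → π.IsUnitarizable) :
    ∀ (w : {w : Pl L // w ≠ v}) (hwS : w.1 ∉ ({v} : Set (Pl L))) (πw : IrrClass (Gqs L w.1)) (hadm : πw.IsAdmissible)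
      (hsph : πw.IsSpherical (cmLocalIntegralLevel L 3 (qsForm L) w.1)),
      LiesOver L μ w.1 (𝔣.𝔳.K w.1) (𝔣.𝔥.KH w.1) (𝔣.𝔳.νQ w) (𝔣.𝔳.νHw w) (𝔣.𝔳.mH w) (𝔣.𝔳.mQ w) πw (𝔣.𝔥.ρ w.1) →
        unopClassSphericalCharacter (cmLocalIntegralLevel L 3 (qsForm L) w.1) πw hsph = (t₀OfRecord hunr hμω 𝔣 hPS hUBC).1 ⟨w.1, hwS⟩ :=
  hbc_of_hex L μ v νHv νQv mHv mQv πSt 𝔣 ({v} : Set (Pl L)) (t₀OfRecord hunr hμω 𝔣 hPS hUBC).1 hunr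
    (HeckeCharacter.galConj_eq_inv_of_restrict_eq_quadraticHeckeCharCM L μ hμω)
    (hFL_of_letters L μ v νHv νQv mHv mQv πSt 𝔣 ({v} : Set (Pl L)) hμu hμω hunr hodd hdy) (hex_ofRecord hunr hμω 𝔣 hPS hUBC)

end Frozen

end Summit.HodgeConjecture.HodgeConjecture.R90.S10

end
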